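/-
Copyright (c) 2026 The decomp-a2c cell. All rights reserved.
Released under Apache 2.0 license as described in the file LICENSE.
-/
import Summits.AtomisticToContinuum.Crystallization.Theorems.ChartedZeroExcessLayeredLatticeLiouvilleXA
import Summits.AtomisticToContinuum.Crystallization.Theorems.ChartedZeroExcessLayeredLatticeLiouvilleUX

/-!
# ChartedZeroExcessLayeredLatticeLiouville — part XB «Docket»: the SB-glue with (LD) DISCHARGED
  (decomp-a2c-lens-2, g58; annex to part XA; helper of stmt-AtomisticToContinuum-26636)

Bookkeeping only (modus ponens over parts UX and XA), in the format of part UX: [SBᵇ] `SubWindowBudgetBPG ϑ aHi Λ θ s` and [CC°_Ψᵇ] now follow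
from the two typed glues (`SubWindowBudgetGlueBPG`, `CaccioppoliGlueBPG`) and the REMAINING open leaves only:
(RC) `EquilChartStrainP s' Λ' ν'` · (I4ˢ) `TailFluxBSP aHi Λ' θ s'` · hU `UniformTameStabilityE s Λ ν` · hN `EnergyNearChartPX aHi Λ θ s ν` (+ [KS] for [CC°_Ψᵇ])
— the newly struck piece being (LD) `linearExcessDecayZ_holds` (part XA: (LD′) `modalLipschitzZ_holds` via VV…WZ, then VG `linearExcessDecayZ_of_modalLipschitzZ`),
after (I1), (PT), (HC), (T) struck in part UX.  The record example re-runs the docket of record (`strainNonConcentrationBPG_1_50_of_docketPsi`, part UN)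
at column `_16XH19B`'s literals with one hypothesis fewer than part UX's.  No statement is re-typed.

RESIDUE LIST of the column of record after this part: the two typed glues; (RC)(1/25, 3, 1/1000); (I4ˢ)(1, 3, 1/16, 1/25); hU (1/50, 2, 1/2000);
hN (1, 2, 1/16, 1/50, 1/2000); [KS](1, 1/16); the residual windows [T_bᵇ] `BareTameWindowBPG …`, [W_Ψᵇ] `CoherentWindowPsiBPG …`; the dressed core
`DressedCorePG …`; and the Literature fact `ZatorskaGoldstein2005_localGehringLemmaCounting`.
-/

noncomputable section

open Literature.Analysis.PDE (ZatorskaGoldstein2005_localGehringLemmaCounting)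

namespace Summit.AtomisticToContinuum.Crystallization.Theorems.ChartedZeroExcessLayeredLatticeLiouville

/-- ★ [SBᵇ] from the SB-glue and its OPEN leaves (RC), (I4ˢ), hU, hN — (LD) discharged by part XA `linearExcessDecayZ_holds`
(and (T), (HC), (PT), (I1) by parts UW, UU, US, UP as in part UX). [this file, g58] -/
theorem subWindowBudgetBPG_of_leaves {ϑ aHi Λ Λ' θ s s' ν ν' : ℝ} (hglue : SubWindowBudgetGlueBPG ϑ aHi Λ Λ' θ s s' ν ν')
    (hRC : EquilChartStrainP s' Λ' ν') (h4 : TailFluxBSP aHi Λ' θ s') (hU : UniformTameStabilityE s Λ ν) (hN : EnergyNearChartPX aHi Λ θ s ν) :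
    SubWindowBudgetBPG ϑ aHi Λ θ s :=
  subWindowBudgetBPG_of_open_pieces hglue linearExcessDecayZ_holds hRC h4 hU hN

/-- ★★ [CC°_Ψᵇ] from the two glues and the OPEN leaves (RC), (I4ˢ), hU, hN, [KS] — (LD) discharged by part XA. [this file, g58] -/
theorem coherentGscCaccioppoliPsiBPG_of_leaves {ϑ aHi Λ Λ' θ s s' ν ν' : ℝ} (hs : s ≤ s') (hΛ : Λ ≤ Λ')
    (hglueC : CaccioppoliGlueBPG ϑ aHi Λ θ s ν) (hglueS : SubWindowBudgetGlueBPG ϑ aHi Λ Λ' θ s s' ν ν')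
    (hRC : EquilChartStrainP s' Λ' ν') (h4 : TailFluxBSP aHi Λ' θ s') (hU : UniformTameStabilityE s Λ ν) (hN : EnergyNearChartPX aHi Λ θ s ν)
    (hKS : KornSobolevPoincareP aHi θ) : CoherentGscCaccioppoliPsiBPG ϑ aHi Λ θ s :=
  coherentGscCaccioppoliPsiBPG_of_open_pieces hs hΛ hglueC hglueS linearExcessDecayZ_holds hRC h4 hU hN hKS

/-- Record example: the docket of record (`strainNonConcentrationBPG_1_50_of_docketPsi`, part UN) at column `_16XH19B`'s literals with [CC°_Ψᵇ] unfolded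
into its glues and ONLY the open leaves as hypotheses: residuals [T_bᵇ], [W_Ψᵇ]; the two typed glues; (RC)(1/25, 3, 1/1000), (I4ˢ)(3, 1/25), hU, hN, [KS]
— (LD), (T), (HC), (PT), (I1), (I0), (I5) are theorems (one hypothesis fewer than part UX's record example). -/
example (hG : ZatorskaGoldstein2005_localGehringLemmaCounting)
    (hI : DressedCorePG tameRadius dressLevel dressLevel dressExponent 8 collarRadius clusterSize 1 2 (1 / 16) (1 / 50))
    (hTb : BareTameWindowBPG tameRadius dressLevel dressLevel dressExponent 8 collarRadius clusterSize 1 2 (1 / 16) (1 / 50))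
    (hKS : KornSobolevPoincareP 1 (1 / 16)) (hW : CoherentWindowPsiBPG tameRadius 1 2 (1 / 16) (1 / 50))
    (hglueC : CaccioppoliGlueBPG tameRadius 1 2 (1 / 16) (1 / 50) (1 / 2000))
    (hglueS : SubWindowBudgetGlueBPG tameRadius 1 2 3 (1 / 16) (1 / 50) (1 / 25) (1 / 2000) (1 / 1000))
    (hRC : EquilChartStrainP (1 / 25) 3 (1 / 1000)) (h4 : TailFluxBSP 1 3 (1 / 16) (1 / 25))
    (hU : UniformTameStabilityE (1 / 50) 2 (1 / 2000)) (hN : EnergyNearChartPX 1 2 (1 / 16) (1 / 50) (1 / 2000)) :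
    StrainNonConcentrationBPG 1 2 (1 / 16) (1 / 50) :=
  strainNonConcentrationBPG_1_50_of_docketPsi hG hI hTb hKS hW
    (coherentGscCaccioppoliPsiBPG_of_leaves (by norm_num) (by norm_num) hglueC hglueS hRC h4 hU hN hKS)

/-- The content of part XB as one closed proposition: [SBᵇ] and [CC°_Ψᵇ] from the glues and the open leaves (RC), (I4ˢ), hU, hN (, [KS]). -/
def DocketShape : Prop :=
  (∀ ϑ aHi Λ Λ' θ s s' ν ν' : ℝ, SubWindowBudgetGlueBPG ϑ aHi Λ Λ' θ s s' ν ν' → EquilChartStrainP s' Λ' ν' → TailFluxBSP aHi Λ' θ s' →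
    UniformTameStabilityE s Λ ν → EnergyNearChartPX aHi Λ θ s ν → SubWindowBudgetBPG ϑ aHi Λ θ s) ∧
  (∀ ϑ aHi Λ Λ' θ s s' ν ν' : ℝ, s ≤ s' → Λ ≤ Λ' → CaccioppoliGlueBPG ϑ aHi Λ θ s ν → SubWindowBudgetGlueBPG ϑ aHi Λ Λ' θ s s' ν ν' →
    EquilChartStrainP s' Λ' ν' → TailFluxBSP aHi Λ' θ s' → UniformTameStabilityE s Λ ν → EnergyNearChartPX aHi Λ θ s ν → KornSobolevPoincareP aHi θ →
    CoherentGscCaccioppoliPsiBPG ϑ aHi Λ θ s)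

/-- XB holds. [this file, g58] -/
theorem docketShape_holds : DocketShape :=
  ⟨fun _ _ _ _ _ _ _ _ _ hglue hRC h4 hU hN => subWindowBudgetBPG_of_leaves hglue hRC h4 hU hN,
    fun _ _ _ _ _ _ _ _ _ hs hΛ hglueC hglueS hRC h4 hU hN hKS => coherentGscCaccioppoliPsiBPG_of_leaves hs hΛ hglueC hglueS hRC h4 hU hN hKS⟩

end Summit.AtomisticToContinuum.Crystallization.Theorems.ChartedZeroExcessLayeredLatticeLiouville

end
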